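import Summits.QuantumFields.BalabanUV.Beta.FP.TorusCompositeUnimodular
import Summits.QuantumFields.BalabanUV.Beta.FP.TorusOneShotFPExponential
import Summits.QuantumFields.BalabanUV.Beta.FP.NestedStepLawOneShot

/-!
# `BalabanUV.Beta.FP.TorusCompositeFP` — road «FP» for binder row D1, ROUTE T, SPEC-27 (SLICE-m) part 2: **`uP'` IS AUTOMATIC AT EVERY DEPTH — the
# one-shot Faddeev–Popov 2-jet of the composite literal vanishes identically for the exponential generator jets along every direction** (the tower
# twin of `TorusOneShotFPExponential.eval_eq ∕ torus_uP_exp`)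

WHAT.  With the comb tower of `FP/TorusCompositeObjects` and the unipotent `towerEvalC` of `FP/TorusCompositeUnimodular` (leaf-06 g20): §1 the tower
POINT-EVALUATION matrix `evalN Lc M rs n y` of the nested modes at a family of finest-lattice points `y` (top block: the `bigRatio Lc n`-block index of the
point against the top residual parameters; lower: recursion) and **the tower eval lemma `evalN_eq : evalN = (big-comb modes' point evaluation, columns
sorted by towerEquiv) · towerEvalC`** — induction, the step IS `eval_eq` at the single-shot presentation `fine (bigRatio Lc n) M`, transported by
`tdelta_congr ∕ resCongr`; §2 **`bigP_mul_tipJets_eq`**: the one-shot slice against an `f`-weighted tip-type tower jet is the big comb's own pairing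
`combRowsT · D_f↾Res_big`, re-indexed, times `towerEvalC`; §3 **`torus_uP_exp_tower`**: for EVERY bond weight `w` and every `c`, with the one-shot
chart's generator jets in the exponential closed forms `W₁ = of (−c·w b·evalN tip b e)`, `W₂ = of ((c·w b)²·evalN tip b e)`:
`secondVar (bigP · towerGen) (bigP · W₁) (bigP · W₂) = 0` — `secondVar_combRowsT_expJets_eq_zero` on the big comb (ANY comb) after stripping the common
unipotent factor (`secondVar_mul_right`, `det towerEvalC = 1`) and the common re-indexing (`secondVar_submatrix_equiv`).  At `n = 1` this is
`torus_uP_exp` (p324263) on the nose (`bigP_one ∕ towerGen_one`, `evalN … 1` = its `Sum.elim` evaluation).  [folklore] over OUR torus objects.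

HONEST DEPENDENCY (page 1, mandatory): continuum YM on T⁴ ⇐ BetaPertH ∧ nine spine estimates (0/9 proved); BetaPertH ⇐ (D1) ∧ (D4) ∧ CAP+tail;
G-an2-4 gates asym, D1 and NE2/3/4.  HONEST FRAMING (cell contract, verbatim): «discharging `BetaPertH` makes Bałaban's UV stability UNCONDITIONAL —
a real constructive-QFT result; it is NOT the continuum limit and NOT the Clay problem.»  ABSOLUTE RULE (cell charter, verbatim): «No internally-minted
statement may enter as a cited fact. Every hypothesis is either kernel-proved in this package or a verbatim quotation of a PUBLISHED theorem with page
reference. The manuscript(s) under audit are NOT citable for their own disputed steps — they are the thing under adjudication; programme-internal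
(2001/route/tribunal) claims are never citable.»  [our object] bookkeeping + [folklore] linear algebra; no `def … : Prop`, nothing cited, 0 sorry;
0 estimates; 0∕4 row-D1 binders; NOT (T-ID), NOT SDF, NOT D1, NOT BetaPertH, NOT continuum, NOT Clay.  D1 formalisation swarm LEAF PROVER 06
(b2b-balaban-beta-d1-formalise-leaf-06 gen 20), 2026-08-22.  No existing file touched.
-/

noncomputable section

namespace Summit.QuantumFields.BalabanUV.Beta.FP.TorusCompositeFP

open Matrix
open Literature.MathematicalPhysics.QuantumFieldTheory.Balaban1983to89
open Literature.MathematicalPhysics.QuantumFieldTheory.Balaban1983to89.Beta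
open Literature.MathematicalPhysics.QuantumFieldTheory.LatticeForm (quo)
open B5Prop11Plancherel (fine)
open B6Lemma24Torus (pbox)
open AffineAveraging (Site toSite unitVec)
open OneStepResolventKernel (Fib)
open Summit.QuantumFields.BalabanUV.Beta.D1BFx.LogDetSecondVariation (secondVar)
open Summit.QuantumFields.BalabanUV.Beta.FP.KernelPeriodisationFib (Idx)
open Summit.QuantumFields.BalabanUV.Beta.FP.TorusGaugeCovariance (tgrad tdelta)
open Summit.QuantumFields.BalabanUV.Beta.FP.TorusCombRows (Res combRowsT)
open Summit.QuantumFields.BalabanUV.Beta.FP.TorusCombNestedBasis (resBigEquiv evalC submatrix_mul_submatrix combRowsT_fieldSlot_mul)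
open Summit.QuantumFields.BalabanUV.Beta.FP.NestedStepLawOneShot (secondVar_submatrix_equiv)
open Summit.QuantumFields.BalabanUV.Beta.FP.NestedStepLawOneShotLetters (secondVar_mul_right)
open Summit.QuantumFields.BalabanUV.Beta.FP.TorusOneShotFPExponential (eval_eq secondVar_combRowsT_expJets_eq_zero)
open Summit.QuantumFields.BalabanUV.Beta.FP.TorusCompositeObjects
open Summit.QuantumFields.BalabanUV.Beta.FP.TorusCompositeUnimodular

variable {d : ℕ}

/-! ## §1 The tower point-evaluation matrix and the tower eval lemma -/

section Eval

variable (Lc : ℕ) [NeZero Lc]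

/-- [folklore] `tdelta` is natural along an equality of tori. -/
theorem tdelta_congr {A A' : Fin (d + 1) → ℕ} (h : A = A') (x : Site (d + 1)) (s : ↥(pbox A)) :
    tdelta A x s = tdelta A' x (pboxCongr h s) := by
  cases h; rfl

/-- [our object — bookkeeping] **THE TOWER POINT-EVALUATION MATRIX**: the value of the nested mode `e : NParam` at the finest-lattice point `y b` —
top parameters: the indicator that the `bigRatio Lc n`-block of `y b` has index `t̄` (`tdelta M (quo (bigRatio Lc n) (y b)) t̄`); lower parameters: the
tower below.  At `n = 1` it is `torus_uP_exp`'s `Sum.elim (tdelta M′ (quo Lc ·) t̄) (tdelta (fine Lc M′) · s)`. -/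
def evalN {β : Type*} : (M : Fin (d + 1) → ℕ) → (rs : ℕ → (Fin (d + 1) → ℕ)) → (n : ℕ) → (y : β → Site (d + 1)) → Matrix β (NParam Lc M rs n) ℝ
  | M, rs, 0, y => Matrix.of fun (b : β) (t : Res (toSite (rs 0)) Lc M) => tdelta M (y b) t.1
  | M, rs, n + 1, y => Matrix.fromCols (Matrix.of fun (b : β) (t : Res (toSite (rs 0)) Lc M) => tdelta M (quo (bigRatio Lc n) (y b)) t.1)
      (evalN (fine Lc M) (fun k => rs (k + 1)) n y)

omit [NeZero Lc] in
/-- unfolding, depth `0`. -/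
theorem evalN_zero {β : Type*} (M : Fin (d + 1) → ℕ) (rs : ℕ → (Fin (d + 1) → ℕ)) (y : β → Site (d + 1)) :
    evalN Lc M rs 0 y = Matrix.of fun (b : β) (t : Res (toSite (rs 0)) Lc M) => tdelta M (y b) t.1 := rfl

omit [NeZero Lc] in
/-- unfolding, depth `n+1` (TOP block first). -/
theorem evalN_succ {β : Type*} (M : Fin (d + 1) → ℕ) (rs : ℕ → (Fin (d + 1) → ℕ)) (n : ℕ) (y : β → Site (d + 1)) :
    evalN Lc M rs (n + 1) y = Matrix.fromCols (Matrix.of fun (b : β) (t : Res (toSite (rs 0)) Lc M) => tdelta M (quo (bigRatio Lc n) (y b)) t.1)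
      (evalN Lc (fine Lc M) (fun k => rs (k + 1)) n y) := rfl

set_option linter.unusedSimpArgs false in
/-- **THE TOWER EVAL LEMMA** (point-evaluation twin of `towerGenIdx_eq`): the nested modes' point evaluations are the big-comb modes' point evaluations,
columns sorted by `towerEquiv`, times the unipotent `towerEvalC` — induction over `TorusOneShotFPExponential.eval_eq` at the single-shot presentation. -/
theorem evalN_eq {β : Type*} (y : β → Site (d + 1)) :
    ∀ (n : ℕ) (M : Fin (d + 1) → ℕ) [∀ μ, NeZero (M μ)] (rs : ℕ → (Fin (d + 1) → ℕ))
      (hrs : ∀ k i, 0 ≤ toSite (rs k) i ∧ toSite (rs k) i < (Lc : ℤ)),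
      evalN Lc M rs n y
        = (Matrix.of fun (b : β) (x : Res (bigRoot Lc rs n) (bigRatio Lc n) (towerTorus Lc M n)) => tdelta (towerTorus Lc M n) (y b) x.1).submatrix id
            (towerEquiv Lc M rs hrs n).symm
          * towerEvalC Lc M rs hrs n
  | 0, M, _, rs, hrs => by
    rw [towerEvalC, Matrix.mul_one, towerEquiv_zero]; rfl
  | n + 1, M, _, rs, hrs => by
    dsimp only [towerTorus_succ]
    have hLc : 0 < Lc := Nat.pos_of_ne_zero (NeZero.ne Lc)
    haveI : NeZero (bigRatio Lc n) := ⟨(bigRatio_pos Lc hLc n).ne'⟩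
    have hT : towerTorus Lc (fine Lc M) n = fine (bigRatio Lc n) M := towerTorus_fine_eq_fine Lc M n
    have ih := evalN_eq y n (fine Lc M) (fun k => rs (k + 1)) (fun k => hrs (k + 1))
    have w0 := eval_eq (M' := M) (N := bigRatio Lc n) (N₂ := Lc) (ρ := bigRoot Lc (fun k => rs (k + 1)) n) (ρ₂ := toSite (rs 0))
      (bigRatio_pos Lc hLc n) (bigRoot_range Lc hLc n (fun k => rs (k + 1)) (fun k => hrs (k + 1))) hLc (hrs 0) y
    rw [evalN, ih, towerEvalC, towerEquiv_succ]
    set eL := towerEquiv Lc (fine Lc M) (fun k => rs (k + 1)) (fun k => hrs (k + 1)) n with heL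
    set e' : Res (bigRoot Lc (fun k => rs (k + 1)) n) (bigRatio Lc n) (fine (bigRatio Lc n) M) ≃ NParam Lc (fine Lc M) (fun k => rs (k + 1)) n :=
      (resCongr hT.symm).trans eL with he'
    set rbe := resBigEquiv (bigRatio Lc n) Lc (bigRoot Lc (fun k => rs (k + 1)) n) (toSite (rs 0)) M
        (bigRatio_pos Lc hLc n) (bigRoot_range Lc hLc n (fun k => rs (k + 1)) (fun k => hrs (k + 1))) hLc (hrs 0) with hrbe
    set CL := towerEvalC Lc (fine Lc M) (fun k => rs (k + 1)) (fun k => hrs (k + 1)) n with hCL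
    set LS := lowerSort Lc M rs hrs n with hLS
    set A₀ := Matrix.of fun (b : β) (x : Res ((bigRatio Lc n : ℤ) • toSite (rs 0) + bigRoot Lc (fun k => rs (k + 1)) n) (bigRatio Lc n * Lc)
        (fine (bigRatio Lc n) M)) => tdelta (fine (bigRatio Lc n) M) (y b) x.1 with hA₀
    set B₁ := Matrix.of fun (b : β) (t : Res (toSite (rs 0)) Lc M) => tdelta M (quo (bigRatio Lc n) (y b)) t.1 with hB₁
    set B₂ := Matrix.of fun (b : β) (s : Res (bigRoot Lc (fun k => rs (k + 1)) n) (bigRatio Lc n) (fine (bigRatio Lc n) M)) =>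
        tdelta (fine (bigRatio Lc n) M) (y b) s.1 with hB₂
    set F : Matrix (Res (toSite (rs 0)) Lc M ⊕ Res (bigRoot Lc (fun k => rs (k + 1)) n) (bigRatio Lc n) (fine (bigRatio Lc n) M))
        (Res (toSite (rs 0)) Lc M ⊕ Res (bigRoot Lc (fun k => rs (k + 1)) n) (bigRatio Lc n) (fine (bigRatio Lc n) M)) ℝ :=
      Matrix.fromBlocks 1 0 0 (CL.submatrix e' e') with hF
    set Y := evalC (bigRatio Lc n) Lc (bigRoot Lc (fun k => rs (k + 1)) n) (toSite (rs 0)) M * F with hY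
    -- `eval_eq` read as `fromCols B₁ B₂ = A₀↾rbe.symm · evalC` (definitional re-bracketing of the `Sum.elim`)
    have w0' : Matrix.fromCols B₁ B₂ = A₀.submatrix id rbe.symm * evalC (bigRatio Lc n) Lc (bigRoot Lc (fun k => rs (k + 1)) n) (toSite (rs 0)) M := by
      rw [← w0]; ext b c; rcases c with t | s <;> rfl
    have hassoc : Matrix.fromCols B₁ B₂ * F = A₀.submatrix id rbe.symm * Y := by
      rw [w0', hY]; exact Matrix.mul_assoc _ _ _
    have key : (Matrix.fromCols B₁ B₂ * F).submatrix id LS.symm = (A₀.submatrix id rbe.symm).submatrix id LS.symm * Y.submatrix LS.symm LS.symm := by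
      rw [Matrix.submatrix_mul_equiv, hassoc]
    convert key using 1
    · ext b c
      have hLS' : ∀ c', LS.symm c' = (Equiv.sumCongr (Equiv.refl _) e').symm c' := fun _ => rfl
      rcases c with t | x
      · simp only [Matrix.submatrix_apply, hLS', Equiv.sumCongr_symm, Equiv.sumCongr_apply, Equiv.refl_symm, Sum.map_inl, Equiv.coe_refl, id_eq,
          Matrix.fromCols_apply_inl, Matrix.fromCols_apply_inr, Matrix.mul_apply, Fintype.sum_sum_type, hF, Matrix.fromBlocks_apply₁₁,
          Matrix.fromBlocks_apply₂₁, Matrix.zero_apply, mul_zero, Finset.sum_const_zero, add_zero, Matrix.one_apply, mul_ite, mul_one,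
          Finset.sum_ite_eq', Finset.mem_univ, if_true, Matrix.of_apply, hB₁]
      · simp only [Matrix.submatrix_apply, hLS', Equiv.sumCongr_symm, Equiv.sumCongr_apply, Equiv.refl_symm, Sum.map_inr, id_eq,
          Matrix.fromCols_apply_inl, Matrix.fromCols_apply_inr, Matrix.mul_apply, Fintype.sum_sum_type, hF, Matrix.fromBlocks_apply₁₂,
          Matrix.fromBlocks_apply₂₂, Matrix.zero_apply, mul_zero, Finset.sum_const_zero, zero_add, Equiv.apply_symm_apply, Matrix.of_apply]
        rw [← Equiv.sum_comp e']
        refine Finset.sum_congr rfl fun z _ => ?_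
        rw [he', Equiv.trans_apply, Equiv.symm_apply_apply]
        simp only [hB₂, Matrix.of_apply]
        congr 1
        exact tdelta_congr hT _ _
    · congr 1
      ext b c
      simp only [Matrix.submatrix_apply, Matrix.of_apply, id_eq, hA₀]
      exact tdelta_congr hT _ _

/-- [folklore] the `f`-weighted version: `of (f b · evalN y b e) = (of (f b · tdelta (y b) x), sorted) · towerEvalC`. -/
theorem evalN_smul_eq {β : Type*} (y : β → Site (d + 1)) (f : β → ℝ) (n : ℕ) (M : Fin (d + 1) → ℕ) [∀ μ, NeZero (M μ)]
    (rs : ℕ → (Fin (d + 1) → ℕ)) (hrs : ∀ k i, 0 ≤ toSite (rs k) i ∧ toSite (rs k) i < (Lc : ℤ)) :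
    (Matrix.of fun (b : β) (e : NParam Lc M rs n) => f b * evalN Lc M rs n y b e)
      = (Matrix.of fun (b : β) (x : Res (bigRoot Lc rs n) (bigRatio Lc n) (towerTorus Lc M n)) =>
            f b * tdelta (towerTorus Lc M n) (y b) x.1).submatrix id (towerEquiv Lc M rs hrs n).symm
          * towerEvalC Lc M rs hrs n := by
  ext b e
  simp only [Matrix.of_apply]
  rw [evalN_eq Lc y n M rs hrs]
  simp only [Matrix.mul_apply, Matrix.submatrix_apply, Matrix.of_apply, id_eq, Finset.mul_sum, mul_assoc]

end Eval

/-! ## §2 The one-shot slice against a tip-type tower jet, in the big-comb basis -/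

section TipJets

variable (Lc : ℕ) [NeZero Lc]

set_option maxHeartbeats 400000 in
/-- **`P^{(n+1)} · (f-WEIGHTED TIP-TYPE TOWER JET)` IN THE BIG-COMB BASIS** (the tower twin of `TorusOneShotFPExponential.bigComb_P_mul_eval_eq`): with the
tip of the finest bond `b` as the evaluation point, `bigP · of (f b · evalN tip b e) = (combRowsT · D_f↾Res_big)` re-indexed `towerEquiv` × `towerEvalC`,
where `D_f q s := Sum.elim (fun a => f (q.1, a) · tdelta (q.1 + e_a) s) 0 q.2` is the big comb's own tip-type generator matrix. -/
theorem bigP_mul_tipJets_eq (M : Fin (d + 1) → ℕ) [∀ μ, NeZero (M μ)] (rs : ℕ → (Fin (d + 1) → ℕ))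
    (hrs : ∀ k i, 0 ≤ toSite (rs k) i ∧ toSite (rs k) i < (Lc : ℤ)) (hM : ∀ i, Lc ∣ M i) (n : ℕ)
    (f : ↥(pbox (towerTorus Lc M n)) × Fin (d + 1) → ℝ) :
    bigP Lc M rs hrs n
        * Matrix.of (fun (b : ↥(pbox (towerTorus Lc M n)) × Fin (d + 1)) (e : NParam Lc M rs n) =>
            f b * evalN Lc M rs n (fun b' : ↥(pbox (towerTorus Lc M n)) × Fin (d + 1) => (b'.1 : Site (d + 1)) + unitVec b'.2) b e)
      = (combRowsT (bigRoot Lc rs n) (bigRatio Lc n) (towerTorus Lc M n)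
            * (Matrix.of fun (q : Idx (towerTorus Lc M n) (Fib d)) (s : ↥(pbox (towerTorus Lc M n))) =>
                Sum.elim (fun a : Fin (d + 1) => f (q.1, a) * tdelta (towerTorus Lc M n) ((q.1 : Site (d + 1)) + unitVec a) s)
                  (fun _ => (0 : ℝ)) q.2).submatrix id
              (Subtype.val : Res (bigRoot Lc rs n) (bigRatio Lc n) (towerTorus Lc M n) → ↥(pbox (towerTorus Lc M n)))).submatrix
          (towerEquiv Lc M rs hrs n).symm (towerEquiv Lc M rs hrs n).symm
        * towerEvalC Lc M rs hrs n := by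
  have hLc : 0 < Lc := Nat.pos_of_ne_zero (NeZero.ne Lc)
  rw [evalN_smul_eq Lc _ f n M rs hrs, ← Matrix.mul_assoc]
  congr 1
  -- the weighted tip evaluation on the field slots is `D_f↾Res_big` read on the field slots
  have hD : (Matrix.of fun (b : ↥(pbox (towerTorus Lc M n)) × Fin (d + 1)) (x : Res (bigRoot Lc rs n) (bigRatio Lc n) (towerTorus Lc M n)) =>
        f b * tdelta (towerTorus Lc M n) ((b.1 : Site (d + 1)) + unitVec b.2) x.1)
      = ((Matrix.of fun (q : Idx (towerTorus Lc M n) (Fib d)) (s : ↥(pbox (towerTorus Lc M n))) =>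
            Sum.elim (fun a : Fin (d + 1) => f (q.1, a) * tdelta (towerTorus Lc M n) ((q.1 : Site (d + 1)) + unitVec a) s)
              (fun _ => (0 : ℝ)) q.2).submatrix id
          (Subtype.val : Res (bigRoot Lc rs n) (bigRatio Lc n) (towerTorus Lc M n) → ↥(pbox (towerTorus Lc M n)))).submatrix
          (fun b : ↥(pbox (towerTorus Lc M n)) × Fin (d + 1) => ((b.1, Sum.inl b.2) : Idx (towerTorus Lc M n) (Fib d))) id := by
    ext b x; rfl
  rw [hD, bigP]
  set e := towerEquiv Lc M rs hrs n with he
  set P := combRowsT (bigRoot Lc rs n) (bigRatio Lc n) (towerTorus Lc M n) with hP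
  set W := (Matrix.of fun (q : Idx (towerTorus Lc M n) (Fib d)) (s : ↥(pbox (towerTorus Lc M n))) =>
      Sum.elim (fun a : Fin (d + 1) => f (q.1, a) * tdelta (towerTorus Lc M n) ((q.1 : Site (d + 1)) + unitVec a) s)
        (fun _ => (0 : ℝ)) q.2).submatrix id
    (Subtype.val : Res (bigRoot Lc rs n) (bigRatio Lc n) (towerTorus Lc M n) → ↥(pbox (towerTorus Lc M n))) with hW
  have h1 : P.submatrix e.symm (fun b : ↥(pbox (towerTorus Lc M n)) × Fin (d + 1) => ((b.1, Sum.inl b.2) : Idx (towerTorus Lc M n) (Fib d)))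
        * (W.submatrix (fun b : ↥(pbox (towerTorus Lc M n)) × Fin (d + 1) => ((b.1, Sum.inl b.2) : Idx (towerTorus Lc M n) (Fib d))) id).submatrix
            id e.symm
      = (P.submatrix e.symm (fun b : ↥(pbox (towerTorus Lc M n)) × Fin (d + 1) => ((b.1, Sum.inl b.2) : Idx (towerTorus Lc M n) (Fib d)))
          * W.submatrix (fun b : ↥(pbox (towerTorus Lc M n)) × Fin (d + 1) => ((b.1, Sum.inl b.2) : Idx (towerTorus Lc M n) (Fib d))) id).submatrix
          id e.symm := by
    rw [Matrix.submatrix_mul _ _ id id _ Function.bijective_id, Matrix.submatrix_id_id]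
  have h2 := combRowsT_fieldSlot_mul (bigRatio_pos Lc hLc n) (bigRoot_range Lc hLc n rs hrs) (bigRatio_dvd_towerTorus Lc hM n)
    (fun x : NParam Lc M rs n => e.symm x) W
  have h3 : (P.submatrix e.symm id * W).submatrix id e.symm = (P * W).submatrix e.symm e.symm := by
    rw [Matrix.submatrix_mul (P.submatrix e.symm id) W id id _ Function.bijective_id, Matrix.submatrix_id_id,
      Matrix.submatrix_mul P W _ id _ Function.bijective_id]
  erw [h1, h2, h3]

end TipJets


/-! ## §3 `uP'` of the composite call is automatic for the exponential generator jets -/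

section UP

variable (Lc : ℕ) [NeZero Lc]

/-- **`uP'^{(n)}` IS AUTOMATIC — THE ONE-SHOT FADDEEV–POPOV 2-JET OF THE `(n+1)`-LEVEL LITERAL VANISHES FOR THE EXPONENTIAL GENERATOR JETS ALONG EVERY
DIRECTION.**  With `P := bigP`, `W₀ := towerGen` and, for ANY bond weight `w` on the finest torus and any `c`, the one-shot chart's generator jets in the
exponential closed forms `W₁ = of (−(c·w b·evalN tip b e))`, `W₂ = of ((c·w b)²·evalN tip b e)`: `secondVar (P·W₀) (P·W₁) (P·W₂) = 0`.  PROOF: all three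
products are `(combRowsT · X↾Res_big)` re-indexed `towerEquiv` times the SAME unipotent `towerEvalC` (`bigP_mul_towerGen_eq`, `bigP_mul_tipJets_eq`); strip
the factor (`secondVar_mul_right`, `det towerEvalC = 1`) and the re-indexing (`secondVar_submatrix_equiv`), then `secondVar_combRowsT_expJets_eq_zero`
(ANY comb).  At `n = 1`: `TorusOneShotFPExponential.torus_uP_exp` (p324263). -/
theorem torus_uP_exp_tower (M : Fin (d + 1) → ℕ) [∀ μ, NeZero (M μ)] (rs : ℕ → (Fin (d + 1) → ℕ))
    (hrs : ∀ k i, 0 ≤ toSite (rs k) i ∧ toSite (rs k) i < (Lc : ℤ)) (hM : ∀ i, Lc ∣ M i) (n : ℕ)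
    (c : ℝ) (w : ↥(pbox (towerTorus Lc M n)) × Fin (d + 1) → ℝ)
    {W₁ W₂ : Matrix (↥(pbox (towerTorus Lc M n)) × Fin (d + 1)) (NParam Lc M rs n) ℝ}
    (hW₁ : W₁ = Matrix.of fun (b : ↥(pbox (towerTorus Lc M n)) × Fin (d + 1)) (e : NParam Lc M rs n) =>
        -(c * w b * evalN Lc M rs n (fun b' : ↥(pbox (towerTorus Lc M n)) × Fin (d + 1) => (b'.1 : Site (d + 1)) + unitVec b'.2) b e))
    (hW₂ : W₂ = Matrix.of fun (b : ↥(pbox (towerTorus Lc M n)) × Fin (d + 1)) (e : NParam Lc M rs n) =>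
        (c * w b) ^ 2 * evalN Lc M rs n (fun b' : ↥(pbox (towerTorus Lc M n)) × Fin (d + 1) => (b'.1 : Site (d + 1)) + unitVec b'.2) b e) :
    secondVar (bigP Lc M rs hrs n * towerGen Lc M rs n) (bigP Lc M rs hrs n * W₁) (bigP Lc M rs hrs n * W₂) = 0 := by
  have hLc : 0 < Lc := Nat.pos_of_ne_zero (NeZero.ne Lc)
  have hW₁' : W₁ = Matrix.of fun (b : ↥(pbox (towerTorus Lc M n)) × Fin (d + 1)) (e : NParam Lc M rs n) =>
      (-(c * w b)) * evalN Lc M rs n (fun b' : ↥(pbox (towerTorus Lc M n)) × Fin (d + 1) => (b'.1 : Site (d + 1)) + unitVec b'.2) b e := by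
    rw [hW₁]; ext b e; simp only [Matrix.of_apply]; ring
  rw [hW₁', hW₂, bigP_mul_towerGen_eq Lc M rs hrs hM n, bigP_mul_tipJets_eq Lc M rs hrs hM n, bigP_mul_tipJets_eq Lc M rs hrs hM n,
    secondVar_mul_right _ _ _ _ (by rw [det_towerEvalC]; exact isUnit_one)]
  erw [secondVar_submatrix_equiv]
  exact secondVar_combRowsT_expJets_eq_zero (bigRatio_pos Lc hLc n) (bigRoot_range Lc hLc n rs hrs) (bigRatio_dvd_towerTorus Lc hM n) c w

end UP

end Summit.QuantumFields.BalabanUV.Beta.FP.TorusCompositeFP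

end
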